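import Literature.Analysis.Complex.PositiveHarmonicBoundaryPole
import Literature.Analysis.Complex.InjectiveHolomorphic
import Literature.Probability.RandomPlanarGeometry.ConformalMapCaratheodoryProofs
import Literature.Probability.RandomPlanarGeometry.ConformalMapRiemannProofs
import HarnessLib

/-!
# A positive harmonic function on a Jordan domain vanishing on the boundary off one point

Topic `Literature/Probability/RandomPlanarGeometry` (Jordan domains and their uniformizing maps;
the continuum identification step of Chelkak–Smirnov's Theorem 3.13 in the geometry of the tree
fact `Literature.Probability.LatticeModels.ChelkakSmirnov2011_boundaryNormalisedPoissonKernelLimit`).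

Let `D` be a Jordan domain, `w` holomorphic on an open `U ⊇ D` with `y ∈ U ∩ ∂D`, mapping `D`
bijectively onto the upper half-plane `ℍ`. Then:

* `im_apply_eq_zero_of_mem_frontier` — `w y` is real (a point of `∂D` at which `w` is continuous
  cannot be sent into `ℍ = w(D)`, because `w|_D⁻¹` is continuous there);
* `harmonicOnNhd_comp_of_differentiableOn` — harmonic ∘ holomorphic is harmonic (planar case, via
  Mathlib's local representation `H = Re F`);
* `poissonKernel_cayleyFun` — the disc Poisson kernel seen through the Cayley map:
  `P(C ω, C t) = (1 + t²) Im ω / |ω - t|²` for real `t` (`C z = (z - i)/(z + i)`);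
* **`JordanDomain.eq_mul_im_div_of_tendsto_zero`** — if `H ≥ 0` is harmonic on `D` and `H → 0`
  at every boundary point other than `y`, then for some `m ≥ 0`
  `H u = m · Im w(u) / |w(u) - w(y)|²` on `D` — the Poisson kernel of `D` with pole `y`,
  normalised through `w` (D. Chelkak, S. Smirnov, Adv. Math. 228 (2011), proof of Thm. 3.13:
  "`H ≥ 0` is harmonic in `Ω`, vanishes on `∂Ω ∖ {a}` … hence is proportional to the Poisson
  kernel"). Proof: `φ = (C ∘ w|_D)⁻¹ : 𝔻 → D` is a conformal equivalence (holomorphic inverse: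
  `Complex.differentiableOn_invFunOn_image`, `SCV.deriv_ne_zero_of_injOn`); by Carathéodory's
  theorem (tree: `exists_continuousOn_extension_holds`) it extends to a homeomorphism-like
  bijection `Φ` of the closed disc onto `closure D`, circle onto `∂D`, with `Φ(C(w y)) = y`; so
  `h = H ∘ Φ` is a nonnegative harmonic function on `𝔻` tending to `0` at every point of the
  circle but `p = C(w y)`, hence `h = m P(·, p)`
  (`Literature.Analysis.Complex.eq_mul_poissonKernel_of_tendsto_zero`), and the formula follows
  from `poissonKernel_cayleyFun`.

Everything is proved, [folklore] apart from the cited reading of Chelkak–Smirnov.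
-/

noncomputable section

namespace Literature.Probability.RandomPlanarGeometry

open _root_.Complex Metric Set Filter InnerProductSpace Function _root_.Topology
open UpperHalfPlane (upperHalfPlaneSet isOpen_upperHalfPlaneSet)

/-! ### Harmonic ∘ holomorphic -/

/-- **Harmonic ∘ holomorphic is harmonic** (planar case): if `H` is harmonic on an open `V` and
`φ` is holomorphic on an open `U` with `φ(U) ⊆ V`, then `H ∘ φ` is harmonic on `U` (locally
`H = Re F` with `F` holomorphic, and `Re (F ∘ φ)` is harmonic). [folklore] -/
theorem harmonicOnNhd_comp_of_differentiableOn {H : ℂ → ℝ} {V U : Set ℂ} (hV : IsOpen V)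
    (hU : IsOpen U) (hH : HarmonicOnNhd H V) {φ : ℂ → ℂ} (hφ : DifferentiableOn ℂ φ U)
    (hmaps : MapsTo φ U V) : HarmonicOnNhd (fun z => H (φ z)) U := by
  intro z hz
  obtain ⟨r, hr, hrV⟩ := Metric.isOpen_iff.1 hV (φ z) (hmaps hz)
  obtain ⟨F, hF, hFre⟩ := (hH.mono hrV).exists_analyticOnNhd_ball_re_eq
  have hφc : ContinuousAt φ z := (hφ.differentiableAt (hU.mem_nhds hz)).continuousAt
  have hev : ∀ᶠ w in 𝓝 z, φ w ∈ ball (φ z) r :=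
    hφc.eventually (isOpen_ball.mem_nhds (mem_ball_self hr))
  have heq : (fun w => H (φ w)) =ᶠ[𝓝 z] fun w => (F (φ w)).re := by
    filter_upwards [hev] with w hw
    exact (hFre hw).symm
  rw [harmonicAt_congr_nhds heq]
  have hφa : AnalyticAt ℂ φ z := (hφ.analyticOnNhd hU) z hz
  exact ((hF (φ z) (mem_ball_self hr)).comp hφa).harmonicAt_re

/-! ### The Cayley map and the Poisson kernel -/

/-- `C t - C ω = 2i(t - ω)/((t + i)(ω + i))` for any `t, ω` off `-i` (the version of
`DiskMoebius.cayleyFun_sub_cayleyFun`, which is stated for two points of `ℍ`, needed here with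
`t` real). [folklore] -/
theorem cayleyFun_sub_cayleyFun' {t ω : ℂ} (ht : t + I ≠ 0) (hω : ω + I ≠ 0) :
    cayleyFun t - cayleyFun ω = 2 * I * (t - ω) / ((t + I) * (ω + I)) := by
  rw [cayleyFun_apply, cayleyFun_apply]
  field_simp
  ring

/-- **The disc Poisson kernel through the Cayley map**: for `t ∈ ℝ` and `Im ω > 0`,
`P(C ω, C t) = (1 + t²) Im ω/|ω - t|²`, i.e. the half-plane Poisson kernel with pole `t` up to
the factor `1 + t²`. [folklore] -/
theorem poissonKernel_cayleyFun {ω : ℂ} (hω : 0 < ω.im) (t : ℝ) :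
    poissonKernel 0 (cayleyFun ω) (cayleyFun t) = (1 + t ^ 2) * ω.im / ‖ω - t‖ ^ 2 := by
  have hωI : ω + I ≠ 0 := add_I_ne_zero hω.le
  have htI : (t : ℂ) + I ≠ 0 := add_I_ne_zero (by simp)
  have hωt : ω - t ≠ 0 := by
    intro h; rw [sub_eq_zero] at h; rw [h] at hω; simp at hω
  rw [Literature.Analysis.Complex.poissonKernel_zero_eq, norm_cayleyFun_ofReal, one_pow,
    cayleyFun_sub_cayleyFun' htI hωI, cayleyFun_apply]
  -- squares of norms as `normSq`
  simp only [Complex.sq_norm, map_div₀, map_mul, Complex.normSq_ofNat, Complex.normSq_I, mul_one]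
  have hn1 : normSq (ω + I) ≠ 0 := (map_ne_zero normSq).2 hωI
  have hn2 : normSq ((t : ℂ) + I) ≠ 0 := (map_ne_zero normSq).2 htI
  have hn3 : normSq (ω - t) ≠ 0 := (map_ne_zero normSq).2 hωt
  have hn3' : normSq ((t : ℂ) - ω) ≠ 0 := by rwa [← normSq_neg, neg_sub]
  have key1 : normSq (ω + I) - normSq (ω - I) = 4 * ω.im := normSq_add_I_sub_normSq_sub_I ω
  have key2 : normSq ((t : ℂ) + I) = 1 + t ^ 2 := by
    rw [normSq_apply]; simp; ring
  have key3 : normSq ((t : ℂ) - ω) = normSq (ω - t) := by rw [← normSq_neg, neg_sub]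
  rw [key3]
  field_simp
  rw [key2]
  nlinarith [key1]

/-! ### A boundary point is not mapped into the half-plane -/

/-- **`w y` is real.** Let `w` map the open set `D` bijectively onto `ℍ` with inverse continuous
on `ℍ` (e.g. a conformal equivalence), and let `w` be continuous at a point `y ∈ ∂D` (within
`D ∪ {y}`). Then `Im w(y) = 0`: `w y ∈ closure ℍ`, and `w y ∈ ℍ` would force `y = w⁻¹(w y) ∈ D`
by continuity of the inverse. [folklore] -/
theorem im_apply_eq_zero_of_mem_frontier {D : Set ℂ} (hD : IsOpen D) {w g : ℂ → ℂ}
    (hbij : BijOn w D upperHalfPlaneSet) (hg : ContinuousOn g upperHalfPlaneSet)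
    (hgmaps : MapsTo g upperHalfPlaneSet D) (hgw : ∀ u ∈ D, g (w u) = u) {y : ℂ}
    (hy : y ∈ frontier D) (hwy : ContinuousWithinAt w D y) : (w y).im = 0 := by
  have hycl : y ∈ closure D := frontier_subset_closure hy
  have hyD : y ∉ D := fun h => hy.2 (by rwa [hD.interior_eq])
  have hcl : w y ∈ closure upperHalfPlaneSet := by
    have := hwy.mem_closure_image hycl
    rw [hbij.image_eq] at this
    exact this
  rw [mem_closure_upperHalfPlaneSet_iff] at hcl
  rcases hcl.lt_or_eq with hpos | h0
  · exfalso
    have hmem : w y ∈ upperHalfPlaneSet := hpos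
    -- `g ∘ w → g (w y)` along `D`, but `g ∘ w = id` on `D`
    have h1 : Tendsto w (𝓝[D] y) (𝓝[upperHalfPlaneSet] (w y)) :=
      tendsto_nhdsWithin_iff.2 ⟨hwy.tendsto, eventually_nhdsWithin_of_forall fun u hu => hbij.mapsTo hu⟩
    have h2 : Tendsto (fun u => g (w u)) (𝓝[D] y) (𝓝 (g (w y))) := (hg _ hmem).tendsto.comp h1
    have h3 : Tendsto (fun u : ℂ => u) (𝓝[D] y) (𝓝 (g (w y))) :=
      h2.congr' (eventually_nhdsWithin_of_forall fun u hu => hgw u hu)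
    have h4 : Tendsto (fun u : ℂ => u) (𝓝[D] y) (𝓝 y) := tendsto_nhdsWithin_of_tendsto_nhds tendsto_id
    haveI : (𝓝[D] y).NeBot := mem_closure_iff_nhdsWithin_neBot.1 hycl
    have heq : g (w y) = y := tendsto_nhds_unique h3 h4
    exact hyD (heq ▸ hgmaps hmem)
  · exact h0.symm

/-! ### The Carathéodory extension of `(C ∘ w|_D)⁻¹` -/

namespace JordanDomain

variable (D : JordanDomain)

/-- **The boundary extension of the Riemann map `(C ∘ w|_D)⁻¹ : 𝔻 → D`.** Let `w` be holomorphic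
on an open `U ⊇ D` and map `D` bijectively onto `ℍ`; `C` the Cayley map `ℍ → 𝔻`. Then
`φ = (C ∘ w|_D)⁻¹` is a conformal equivalence `𝔻 → D`, and its Carathéodory extension `Φ`
(continuous on the closed disc, a bijection onto `closure D`, circle onto `∂D`) satisfies
`Φ (C (w u)) = u` on `D` and, at every boundary point `ζ ∈ ∂D ∩ U`, `w ζ ∈ ℝ` and
`Φ (C (w ζ)) = ζ`. [folklore] -/
theorem exists_extension_comp_cayleyFun_eq {w : ℂ → ℂ} {U : Set ℂ} (hU : IsOpen U)
    (hDU : D.carrier ⊆ U) (hw : DifferentiableOn ℂ w U) (hbij : BijOn w D.carrier upperHalfPlaneSet) :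
    ∃ Φ : ℂ → ℂ, ContinuousOn Φ (closedBall 0 1) ∧ BijOn Φ (closedBall 0 1) (closure D.carrier) ∧
      BijOn Φ (sphere 0 1) (frontier D.carrier) ∧
      (∃ φ : ConformalEquiv (ball (0 : ℂ) 1) D.carrier, EqOn Φ φ (ball 0 1)) ∧
      (∀ u ∈ D.carrier, Φ (cayleyFun (w u)) = u) ∧
      (∀ ζ ∈ frontier D.carrier, ζ ∈ U → (w ζ).im = 0 ∧ Φ (cayleyFun (w ζ)) = ζ) := by
  have hDo : IsOpen D.carrier := D.isOpen
  have hwD : DifferentiableOn ℂ w D.carrier := hw.mono hDU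
  have hinj : InjOn w D.carrier := hbij.injOn
  -- the inverse of `w|_D` is holomorphic on `ℍ`
  have hderiv : ∀ z ∈ D.carrier, deriv w z ≠ 0 := fun z hz =>
    Literature.Analysis.Complex.SCV.deriv_ne_zero_of_injOn hwD hDo hinj hz
  have hinv : DifferentiableOn ℂ (invFunOn w D.carrier) upperHalfPlaneSet := by
    have := Complex.differentiableOn_invFunOn_image hDo hwD hinj hderiv
    rwa [hbij.image_eq] at this
  set ψ : ConformalEquiv D.carrier upperHalfPlaneSet := ConformalEquiv.ofBijOn w hwD hbij hinv with hψ
  have hginv : ∀ u ∈ D.carrier, invFunOn w D.carrier (w u) = u := fun u hu =>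
    hinj.leftInvOn_invFunOn hu
  have hgmaps : MapsTo (invFunOn w D.carrier) upperHalfPlaneSet D.carrier :=
    hbij.surjOn.mapsTo_invFunOn
  -- the Riemann map `φ : 𝔻 → D` and its Carathéodory extension `Φ`
  set φ : ConformalEquiv (ball (0 : ℂ) 1) D.carrier := cayley.symm.trans ψ.symm with hφ
  have hφapply : ∀ z, φ z = invFunOn w D.carrier (cayleyInvFun z) := fun z => rfl
  obtain ⟨Φ, hΦc, hΦeq, hΦbij, hΦbij'⟩ := exists_continuousOn_extension_holds D φ
  -- `Φ ∘ C ∘ w = id` on `D`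
  have hCw_ball : ∀ u ∈ D.carrier, cayleyFun (w u) ∈ ball (0 : ℂ) 1 := fun u hu =>
    cayley.mapsTo (hbij.mapsTo hu)
  have hΦCw : ∀ u ∈ D.carrier, Φ (cayleyFun (w u)) = u := by
    intro u hu
    have hpos : 0 < (w u).im := hbij.mapsTo hu
    rw [hΦeq (hCw_ball u hu), hφapply, cayleyInvFun_cayleyFun (add_I_ne_zero hpos.le), hginv u hu]
  refine ⟨Φ, hΦc, hΦbij, hΦbij', ⟨φ, hΦeq⟩, hΦCw, fun ζ hζ hζU => ?_⟩
  -- boundary points in `U`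
  have hwζ : ContinuousWithinAt w D.carrier ζ :=
    ((hw.differentiableAt (hU.mem_nhds hζU)).continuousAt).continuousWithinAt
  have hreal : (w ζ).im = 0 :=
    im_apply_eq_zero_of_mem_frontier hDo hbij ψ.symm.continuousOn hgmaps hginv hζ hwζ
  refine ⟨hreal, ?_⟩
  have hwζI : w ζ + I ≠ 0 := add_I_ne_zero hreal.ge
  have hwζ_eq : w ζ = (((w ζ).re : ℝ) : ℂ) := by
    apply Complex.ext <;> simp [hreal]
  set p : ℂ := cayleyFun (w ζ) with hp
  have hp1 : ‖p‖ = 1 := by rw [hp, hwζ_eq]; exact norm_cayleyFun_ofReal _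
  have hpcl : p ∈ closedBall (0 : ℂ) 1 := by
    rw [mem_closedBall, dist_zero_right, hp1]
  have hζcl : ζ ∈ closure D.carrier := frontier_subset_closure hζ
  haveI : (𝓝[D.carrier] ζ).NeBot := mem_closure_iff_nhdsWithin_neBot.1 hζcl
  -- `C ∘ w → p` along `D`, and `Φ ∘ C ∘ w = id` there
  have hC : ContinuousAt cayleyFun (w ζ) :=
    continuousOn_cayleyFun.continuousAt
      ((isOpen_ne_fun (by fun_prop) continuous_const).mem_nhds hwζI)
  have h1 : Tendsto (fun u => cayleyFun (w u)) (𝓝[D.carrier] ζ) (𝓝 p) :=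
    hC.tendsto.comp hwζ.tendsto
  have h2 : Tendsto (fun u => cayleyFun (w u)) (𝓝[D.carrier] ζ) (𝓝[closedBall 0 1] p) :=
    tendsto_nhdsWithin_iff.2 ⟨h1, eventually_nhdsWithin_of_forall fun u hu =>
      ball_subset_closedBall (hCw_ball u hu)⟩
  have h3 : Tendsto (fun u => Φ (cayleyFun (w u))) (𝓝[D.carrier] ζ) (𝓝 (Φ p)) :=
    (hΦc p hpcl).tendsto.comp h2
  have h4 : Tendsto (fun u : ℂ => u) (𝓝[D.carrier] ζ) (𝓝 (Φ p)) :=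
    h3.congr' (eventually_nhdsWithin_of_forall fun u hu => hΦCw u hu)
  exact tendsto_nhds_unique h4 (tendsto_nhdsWithin_of_tendsto_nhds tendsto_id)

/-- **Distinct boundary points have distinct images**: with `w` as above, two points of `∂D ∩ U`
with the same image under `w` coincide (both are `Φ (C (w ζ))`). In particular the denominators
`w u - w y`, `w x - w y` of the normalised Poisson kernel do not vanish. [folklore] -/
theorem apply_ne_apply_of_mem_frontier {w : ℂ → ℂ} {U : Set ℂ} (hU : IsOpen U)
    (hDU : D.carrier ⊆ U) (hw : DifferentiableOn ℂ w U) (hbij : BijOn w D.carrier {z : ℂ | 0 < z.im})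
    {x y : ℂ} (hx : x ∈ frontier D.carrier) (hxU : x ∈ U) (hy : y ∈ frontier D.carrier)
    (hyU : y ∈ U) (hxy : x ≠ y) : w x ≠ w y := by
  obtain ⟨Φ, -, -, -, -, -, hbdry⟩ := D.exists_extension_comp_cayleyFun_eq hU hDU hw hbij
  intro h
  have h1 := (hbdry x hx hxU).2
  have h2 := (hbdry y hy hyU).2
  rw [h, h2] at h1
  exact hxy h1.symm

/-! ### The theorem -/

/-- **A nonnegative harmonic function on a Jordan domain vanishing on the boundary off one point is
a multiple of the Poisson kernel with that pole.** Let `w` be holomorphic on an open `U ⊇ D` with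
`y ∈ U ∩ ∂D`, mapping `D` bijectively onto `ℍ = {Im > 0}`; let `H ≥ 0` be harmonic on `D` with
`H(u) → 0` as `u → ζ` inside `D`, for every `ζ ∈ ∂D ∖ {y}`. Then there is `m ≥ 0` with
`H(u) = m · Im w(u) / |w(u) - w(y)|²` for all `u ∈ D`.
[cite: ChelkakSmirnov2011, proof of Thm. 3.13 (identification of the limit `H = P`)] -/
theorem eq_mul_im_div_of_tendsto_zero {w : ℂ → ℂ} {U : Set ℂ} (hU : IsOpen U)
    (hDU : D.carrier ⊆ U) {y : ℂ} (hy : y ∈ frontier D.carrier) (hyU : y ∈ U)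
    (hw : DifferentiableOn ℂ w U) (hbij : BijOn w D.carrier {z : ℂ | 0 < z.im})
    {H : ℂ → ℝ} (hH : HarmonicOnNhd H D.carrier) (hH0 : ∀ u ∈ D.carrier, 0 ≤ H u)
    (hlim : ∀ ζ ∈ frontier D.carrier, ζ ≠ y → Tendsto H (𝓝[D.carrier] ζ) (𝓝 0)) :
    ∃ m : ℝ, 0 ≤ m ∧ ∀ u ∈ D.carrier, H u = m * ((w u).im / ‖w u - w y‖ ^ 2) := by
  have hDo : IsOpen D.carrier := D.isOpen
  have hbij' : BijOn w D.carrier upperHalfPlaneSet := hbij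
  obtain ⟨Φ, hΦc, hΦbij, hΦbij', ⟨φ, hΦeq⟩, hΦCw, hbdry⟩ :=
    D.exists_extension_comp_cayleyFun_eq hU hDU hw hbij'
  have hCw_ball : ∀ u ∈ D.carrier, cayleyFun (w u) ∈ ball (0 : ℂ) 1 := fun u hu =>
    cayley.mapsTo (hbij'.mapsTo hu)
  obtain ⟨hreal, hΦp⟩ := hbdry y hy hyU
  have hwy_eq : w y = (((w y).re : ℝ) : ℂ) := by
    apply Complex.ext <;> simp [hreal]
  -- the pole on the circle
  set p : ℂ := cayleyFun (w y) with hp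
  have hp1 : ‖p‖ = 1 := by rw [hp, hwy_eq]; exact norm_cayleyFun_ofReal _
  have hpcl : p ∈ closedBall (0 : ℂ) 1 := by
    rw [mem_closedBall, dist_zero_right, hp1]
  -- the transported function `h = H ∘ Φ` on the disc
  set h : ℂ → ℝ := fun z => H (Φ z) with hh
  have hharmφ : HarmonicOnNhd (fun z => H (φ z)) (ball 0 1) :=
    harmonicOnNhd_comp_of_differentiableOn hDo isOpen_ball hH φ.differentiableOn φ.mapsTo
  have hharm : HarmonicOnNhd h (ball 0 1) := by
    intro z hz
    have hev : h =ᶠ[𝓝 z] fun z => H (φ z) := by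
      filter_upwards [isOpen_ball.mem_nhds hz] with z' hz'
      simp only [hh, hΦeq hz']
    rw [harmonicAt_congr_nhds hev]
    exact hharmφ z hz
  have hh0 : ∀ z ∈ ball (0 : ℂ) 1, 0 ≤ h z := fun z hz => by
    simp only [hh, hΦeq hz]; exact hH0 _ (φ.mapsTo hz)
  -- boundary limits of `h` off `p`
  have hhlim : ∀ q : ℂ, ‖q‖ = 1 → q ≠ p → Tendsto h (𝓝[ball (0 : ℂ) 1] q) (𝓝 0) := by
    intro q hq1 hqp
    have hqs : q ∈ sphere (0 : ℂ) 1 := mem_sphere_zero_iff_norm.2 hq1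
    have hqcl : q ∈ closedBall (0 : ℂ) 1 := sphere_subset_closedBall hqs
    have hΦq : Φ q ∈ frontier D.carrier := hΦbij'.mapsTo hqs
    have hΦqy : Φ q ≠ y := by
      intro hqy
      rw [← hΦp] at hqy
      exact hqp (hΦbij.injOn hqcl hpcl hqy)
    have h1 : Tendsto Φ (𝓝[ball (0 : ℂ) 1] q) (𝓝[D.carrier] (Φ q)) := by
      refine tendsto_nhdsWithin_iff.2 ⟨?_, ?_⟩
      · exact ((hΦc q hqcl).mono ball_subset_closedBall).tendsto
      · refine eventually_nhdsWithin_of_forall fun z hz => ?_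
        rw [hΦeq hz]; exact φ.mapsTo hz
    exact (hlim _ hΦq hΦqy).comp h1
  -- the disc theorem
  obtain ⟨m, hm0, hm⟩ :=
    Literature.Analysis.Complex.eq_mul_poissonKernel_of_tendsto_zero hharm hh0 hhlim
  refine ⟨m * (1 + (w y).re ^ 2), by positivity, fun u hu => ?_⟩
  have hpos : 0 < (w u).im := hbij'.mapsTo hu
  have h1 := hm _ (hCw_ball u hu)
  simp only [hh, hΦCw u hu] at h1
  rw [h1, hp, hwy_eq, poissonKernel_cayleyFun hpos, ofReal_re]
  ring

end JordanDomain

end Literature.Probability.RandomPlanarGeometry
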